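import Summits.Langlands.Langlands.Theorems.RamifiedCoefficientSeedAdjointLiftingGL3BirthDefs
import Summits.Langlands.Langlands.Theorems.RamifiedCoefficientSeedAdjointLiftingGL3BirthDefs2
import Summits.Langlands.Langlands.Theorems.RamifiedCoefficientSeedAdjointLiftingGL3StubBigImageScalarHelpers
import Literature.NumberTheory.GaloisRepresentations.NormalSubgroupsGL2
import Literature.NumberTheory.GaloisRepresentations.CyclotomicCharacterSurjectiveProofs
import Literature.NumberTheory.GaloisRepresentations.ModPGaloisRepCyclotomicProofs
import Literature.RingTheory.Valuation.AlgClosedResidue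
import HarnessLib

/-!
# Route `RamifiedCoefficientSeed`, crux `AdjointLiftingGL3` (stmt-Langlands-16779), line `birth`:
# stub `stub_bigImageScalar` (S3) — Dickson: big projective image on `Γ_{ℚ(ζ_p)}` and the scalar
# element off `Γ_{ℚ(ζ_p)}`

Registered stub `stub_bigImageScalar` of the checked skeleton `Cruxes/AdjointLiftingGL3/Lines/birth.lean`
(v4).  For `p ≥ 11` and `τ₀ : Γ_ℚ → GL₂(ℤ̄_p/𝔪)` with finite image such that `ad⁰τ₀` is absolutely
irreducible on `G' = Γ_{ℚ(ζ_p)}` and some `τ₀ g` has projective order `> 5`: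

* `BigProjImageOnCyclotomic p τ₀` — the projective image of `τ₀|_{G'}` is conjugate to a group
  between `PSL₂(𝔽)` and `PGL₂(𝔽)` for a finite subfield `𝔽`;
* `ScalarOffCyclotomic p τ` for every twisted adjoint `τ = P (η̄ · Ad τ₀) P⁻¹` (`IsTwistedAdZero`).

## Proof

Group theory around the accepted Dickson theorem `PGL2.pslTwo_le_conj_le_pglTwo_of_five_le`
(`Literature/GroupTheory/SpecificGroups/PGL2DicksonCharP`):

1. (helper file `…StubBigImageScalarHelpers`) since `Ad⁰ ∘ τ₀` is irreducible on `G'`, the projective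
   image `H'` of `τ₀|_{G'}` fixes no point and stabilises no pair of `ℙ¹(k)`;
2. Dickson for the FULL projective image `H = proj τ₀(Γ_ℚ) ⊇ H'` (the element of order `> 5` lives
   in `H`): `PSL₂(𝔽) ≤ tHt⁻¹ ≤ PGL₂(𝔽)` (`pslTwo_le_conj_projectiveImage_comp_subtype`);
3. `PSL₂(𝔽)` is perfect (`commutator_pslTwo_eq`, from Mathlib's `SL2.commutator_eq_top`), so it lies
   in `t·proj τ₀([Γ_ℚ, Γ_ℚ])·t⁻¹ ≤ tH't⁻¹` because `[Γ_ℚ, Γ_ℚ] ≤ G' = ker χ̄_p`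
   (`le_map_of_commutator_eq_self` of `NormalSubgroupsGL2`,
   `mem_absGaloisGroupAdjoinRootsOfUnity_iff_modP`): this is `BigProjImageOnCyclotomic`;
4. squares of `PGL₂(𝔽)` lie in `PSL₂(𝔽)` (`sq_mem_pslTwo_of_mem_pglTwo`), so for every `σ` there is
   `d ∈ [Γ_ℚ, Γ_ℚ]` with `proj τ₀(σ² d⁻¹) = 1`; with `χ̄_p(σ₀) = 2` (the mod-`p` cyclotomic character
   of `ℚ` is onto: `modPCyclotomicCharacterZMod_rat_surjective'`, from the accepted
   `GaloisRep.cyclotomicCharacter_surjective`) the element `σ = σ₀² d⁻¹` has `χ̄_p(σ) = 4 ≠ 1`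
   (`p ≥ 5`), i.e. `σ ∉ G'`, and `τ₀ σ` is scalar, whence `τ σ = η̄(σ) · 1` by the glue
   `scalarOffCyclotomic_of_isTwistedAdZero` of `…BirthDefs2` (`Ad` kills the centre).

References: ACCGHLNSTT2023 §7.1 (proofs of Lemmas 7.1.5, 7.1.6 (2)); Faber2011 Thm. B;
Dickson1901 §260; Serre1972 §5.2 (iii).
-/

set_option linter.dupNamespace false -- `Summit.Langlands.Langlands` is the mandated namespace

noncomputable section

namespace Summit.Langlands.Langlands.Cruxes.AdjointLiftingGL3.Birth

open scoped MatrixGroups NumberField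
open NumberField IsDedekindDomain Field Filter
open Literature.NumberTheory.GaloisRepresentations Literature.NumberTheory.PAdicHodge
open Literature.NumberTheory.Automorphic
open scoped OnePoint Pointwise Matrix
open Literature.GroupTheory.SpecificGroups Literature.RepresentationTheory.Semisimple

/-! ### `PSL₂(𝔽)` is perfect; squares of `PGL₂(𝔽)` lie in `PSL₂(𝔽)` -/

section PSLTwo

variable {k : Type*} [Field k]

/-- **`PSL₂(𝔽)` is perfect** for a subfield `𝔽 ≤ k` containing some `a ≠ 0` with `a² ≠ 1` (e.g.
`|𝔽| ≥ 4`): the image of Mathlib's `SL2.commutator_eq_top` (`SL₂(𝔽)` is generated by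
transvections, each a commutator). [cite: ACCGHLNSTT2023, §7.1, proof of Lemma 7.1.6 (2)] -/
theorem commutator_pslTwo_eq (F : Subfield k) (hF : ∃ a : F, a ≠ 0 ∧ a ^ 2 ≠ 1) :
    ⁅PGL2.pslTwo F, PGL2.pslTwo F⁆ = PGL2.pslTwo F := by
  obtain ⟨a, ha, ha2⟩ := hF
  unfold PGL2.pslTwo
  rw [MonoidHom.range_eq_map, ← Subgroup.map_commutator, ← commutator_def,
    Matrix.SL2.commutator_eq_top ha ha2]

/-- In characteristic `p ≥ 5` every subfield contains `a = 2` with `a ≠ 0`, `a² = 4 ≠ 1`.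
[folklore] -/
theorem exists_ne_zero_sq_ne_one (p : ℕ) [Fact p.Prime] [CharP k p] (hp5 : 5 ≤ p)
    (F : Subfield k) : ∃ a : F, a ≠ 0 ∧ a ^ 2 ≠ 1 := by
  have hp : p.Prime := Fact.out
  have h2 : ((2 : ℕ) : k) ≠ 0 := by
    rw [Ne, CharP.cast_eq_zero_iff k p]
    intro h; have := Nat.le_of_dvd (by norm_num) h; omega
  have h3 : ((3 : ℕ) : k) ≠ 0 := by
    rw [Ne, CharP.cast_eq_zero_iff k p]
    intro h; have := Nat.le_of_dvd (by norm_num) h; omega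
  refine ⟨2, fun h => h2 ?_, fun h => h3 ?_⟩
  · have h' := congrArg F.subtype h
    rw [map_ofNat, map_zero] at h'
    exact_mod_cast h'
  · have h' := congrArg F.subtype h
    rw [map_pow, map_ofNat, map_one] at h'
    push_cast
    linear_combination h'

/-- **Squares of `PGL₂(𝔽)` lie in `PSL₂(𝔽)`**: `[g]² = [g² / det g]` and `det (g² / det g) = 1`.
[folklore] -/
theorem sq_mem_pslTwo_of_mem_pglTwo (F : Subfield k) {h : PGL(Fin 2, k)} (hh : h ∈ PGL2.pglTwo F) :
    h ^ 2 ∈ PGL2.pslTwo F := by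
  obtain ⟨x, rfl⟩ := hh
  induction x using Matrix.ProjGenLinGroup.induction_on with
  | mk g =>
    set d : Fˣ := Matrix.GeneralLinearGroup.det g with hd
    have hdet : (((d⁻¹ : Fˣ) : F) • ((g : Matrix (Fin 2) (Fin 2) F) * g)).det = 1 := by
      rw [Matrix.det_smul, Matrix.det_mul, Fintype.card_fin]
      have hg : (g : Matrix (Fin 2) (Fin 2) F).det = d := rfl
      rw [hg, Units.val_inv_eq_inv_val, inv_pow, sq, inv_mul_cancel₀]
      exact mul_ne_zero d.ne_zero d.ne_zero
    have key : Matrix.SpecialLinearGroup.toPGL ⟨_, hdet⟩ = Matrix.ProjGenLinGroup.mk g ^ 2 := by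
      rw [← map_pow, Matrix.SpecialLinearGroup.toPGL, MonoidHom.comp_apply,
        Matrix.ProjGenLinGroup.mk_eq_mk_iff]
      refine ⟨d, Units.ext ?_⟩
      rw [Units.val_mul, Matrix.GeneralLinearGroup.coe_scalar, Matrix.scalar_apply,
        ← Matrix.smul_eq_mul_diagonal, Units.val_pow_eq_pow_val, sq]
      change (d : F) • ((((d⁻¹ : Fˣ) : F) • ((g : Matrix (Fin 2) (Fin 2) F) * g))) = _
      rw [smul_smul, Units.mul_inv, one_smul]
    exact ⟨⟨_, hdet⟩, by rw [MonoidHom.comp_apply, key, map_pow]⟩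

end PSLTwo

/-! ### The group-theoretic core: Dickson for `H ⊇ H' ⊇ [H, H] ⊇ PSL₂(𝔽)` -/

section Core

variable {k : Type*} [Field k] [IsAlgClosed k] [DecidableEq k] {p : ℕ} [Fact p.Prime] [CharP k p]
variable {G : Type*} [Group G]

/-- The projective image of a restriction is contained in the projective image. [folklore] -/
theorem projectiveImage_comp_subtype_le {n : Type*} [Fintype n] [DecidableEq n] {R : Type*}
    [CommRing R] (τ₀ : G →* GL n R) (N : Subgroup G) :
    projectiveImage (τ₀.comp N.subtype) ≤ projectiveImage τ₀ := by
  rintro _ ⟨g, rfl⟩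
  exact ⟨(g : G), rfl⟩

/-- The projective image of `τ₀|_N` is the image of `N` under `G → PGL`. [folklore] -/
theorem projectiveImage_comp_subtype_eq_map {n : Type*} [Fintype n] [DecidableEq n] {R : Type*}
    [CommRing R] (τ₀ : G →* GL n R) (N : Subgroup G) :
    projectiveImage (τ₀.comp N.subtype) = N.map (Matrix.ProjGenLinGroup.mk.comp τ₀) := by
  rw [projectiveImage, ← MonoidHom.comp_assoc, MonoidHom.range_comp, N.range_subtype]

omit [IsAlgClosed k] [DecidableEq k] in
/-- Conjugating an image subgroup: `t · f(K) · t⁻¹ = (conj_t ∘ f)(K)`. [folklore] -/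
theorem conj_smul_map_eq (t : PGL(Fin 2, k)) (f : G →* PGL(Fin 2, k)) (K : Subgroup G) :
    MulAut.conj t • K.map f = K.map ((MulAut.conj t).toMonoidHom.comp f) := by
  ext x
  simp only [Subgroup.mem_smul_pointwise_iff_exists, Subgroup.mem_map, MonoidHom.comp_apply,
    MulEquiv.coe_toMonoidHom, MulAut.smul_def]
  constructor
  · rintro ⟨s, ⟨g, hg, rfl⟩, rfl⟩
    exact ⟨g, hg, rfl⟩
  · rintro ⟨g, hg, rfl⟩
    exact ⟨f g, ⟨g, hg, rfl⟩, rfl⟩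

/-- **The core.** `k` algebraically closed of characteristic `p ≥ 5`, `τ₀ : G → GL₂(k)` with finite
image, `N ≤ G` containing `[G, G]`.  If the projective image `H'` of `τ₀|_N` fixes no point and
stabilises no pair of `ℙ¹(k)` and the projective image `H ⊇ H'` of `τ₀` has an element of order
`> 5`, then by Dickson (`PGL2.pslTwo_le_conj_le_pglTwo_of_five_le`, applied to `H`)
`PSL₂(𝔽) ≤ tHt⁻¹ ≤ PGL₂(𝔽)`; `PSL₂(𝔽)` being perfect lies in `t·proj τ₀([G,G])·t⁻¹ ≤ tH't⁻¹`
(`le_map_of_commutator_eq_self`); and squares of `H` lie in `proj τ₀([G, G])`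
(`sq_mem_pslTwo_of_mem_pglTwo`). [cite: ACCGHLNSTT2023, §7.1, proof of Lemma 7.1.6 (2)] -/
theorem pslTwo_le_conj_projectiveImage_comp_subtype (hp5 : 5 ≤ p) (τ₀ : G →* GL (Fin 2) k)
    (hfin : (Set.range τ₀).Finite) (N : Subgroup G) (hN : commutator G ≤ N)
    (hfix : ∀ x : OnePoint k, ∃ h ∈ projectiveImage (τ₀.comp N.subtype), h • x ≠ x)
    (hpair : ∀ x y : OnePoint k, x ≠ y → ∃ h ∈ projectiveImage (τ₀.comp N.subtype),
      ¬ ((h • x = x ∨ h • x = y) ∧ (h • y = x ∨ h • y = y)))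
    (hord : ∃ h ∈ projectiveImage τ₀, 5 < orderOf h) :
    ∃ (F : Subfield k) (t : PGL(Fin 2, k)), Finite F ∧
      PGL2.pslTwo F ≤ MulAut.conj t • projectiveImage (τ₀.comp N.subtype) ∧
      MulAut.conj t • projectiveImage τ₀ ≤ PGL2.pglTwo F ∧
      ∀ σ : G, ∃ d ∈ commutator G,
        Matrix.ProjGenLinGroup.mk (τ₀ d) = Matrix.ProjGenLinGroup.mk (τ₀ σ) ^ 2 := by
  set π : G →* PGL(Fin 2, k) := Matrix.ProjGenLinGroup.mk.comp τ₀ with hπ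
  have hPH : projectiveImage τ₀ = π.range := rfl
  have hle : projectiveImage (τ₀.comp N.subtype) ≤ projectiveImage τ₀ :=
    projectiveImage_comp_subtype_le τ₀ N
  -- finiteness of the projective image
  haveI : Finite (Set.range τ₀) := hfin.to_subtype
  haveI : Finite (projectiveImage τ₀) :=
    Finite.of_surjective (fun x : Set.range τ₀ =>
      (⟨Matrix.ProjGenLinGroup.mk x.1, by obtain ⟨g, hg⟩ := x.2; exact ⟨g, by simp [hg]⟩⟩ :
        projectiveImage τ₀)) (by
      rintro ⟨_, g, rfl⟩
      exact ⟨⟨τ₀ g, g, rfl⟩, rfl⟩)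
  -- Dickson for `H`
  obtain ⟨F, t, hF, h1, h2⟩ := PGL2.pslTwo_le_conj_le_pglTwo_of_five_le p hp5 (projectiveImage τ₀)
    (fun x => by obtain ⟨h, hh, hx⟩ := hfix x; exact ⟨h, hle hh, hx⟩)
    (fun x y hxy => by obtain ⟨h, hh, hx⟩ := hpair x y hxy; exact ⟨h, hle hh, hx⟩) hord
  haveI := hF
  -- `PSL₂(𝔽)` is perfect, hence inside the image of `[G, G]` and of `N`
  have hperf : ⁅PGL2.pslTwo F, PGL2.pslTwo F⁆ = PGL2.pslTwo F :=
    commutator_pslTwo_eq F (exists_ne_zero_sq_ne_one p hp5 F)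
  set π' : G →* PGL(Fin 2, k) := (MulAut.conj t).toMonoidHom.comp π with hπ'
  have h1' : PGL2.pslTwo F ≤ π'.range := by
    rw [MonoidHom.range_eq_map, hπ', ← conj_smul_map_eq, ← MonoidHom.range_eq_map]
    exact h1
  have hSN : PGL2.pslTwo F ≤ N.map π' := le_map_of_commutator_eq_self π' hperf hN h1'
  have hSD : PGL2.pslTwo F ≤ (commutator G).map π' :=
    le_map_of_commutator_eq_self π' hperf le_rfl h1'
  refine ⟨F, t, hF, ?_, h2, fun σ => ?_⟩
  · rw [projectiveImage_comp_subtype_eq_map, conj_smul_map_eq]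
    exact hSN
  · have hσ : MulAut.conj t • π σ ∈ PGL2.pglTwo F :=
      h2 (Subgroup.smul_mem_pointwise_smul _ _ _ ⟨σ, rfl⟩)
    have hsq := hSD (sq_mem_pslTwo_of_mem_pglTwo F hσ)
    rw [hπ', ← conj_smul_map_eq, ← smul_pow', Subgroup.smul_mem_pointwise_smul_iff,
      Subgroup.mem_map] at hsq
    obtain ⟨d, hd, hdeq⟩ := hsq
    exact ⟨d, hd, hdeq⟩

end Core

/-! ### The Galois input: `Γ_{ℚ(ζ_p)} = ker χ̄_p`, and `χ̄_p` is onto -/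

section Cyclotomic

/-- **`Γ_{K(ζ_p)} = ker χ̄_p`.**  `σ ∈ Γ_K` lies in `Γ_{K(μ_p)}` (`absGaloisGroupAdjoinRootsOfUnity K p`:
`σ` fixes every `p`-th root of unity of `K̄`) iff the mod-`p` cyclotomic character is trivial on it
(`modPCyclotomicCharacterZMod_spec`: `σ ζ = ζ ^ {χ̄_p(σ)}`; `modularCyclotomicCharacter.unique`;
the same statement is proved for Caraiani–Newton's Lemma 6.1.4 in the tree). [folklore] -/
theorem mem_absGaloisGroupAdjoinRootsOfUnity_iff_modP {K : Type*} [Field K] {p : ℕ} [Fact p.Prime]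
    [NeZero (p : K)] (σ : absoluteGaloisGroup K) :
    σ ∈ absGaloisGroupAdjoinRootsOfUnity K p ↔ modPCyclotomicCharacterZMod K p σ = 1 := by
  rw [mem_absGaloisGroupAdjoinRootsOfUnity_iff]
  constructor
  · intro h
    ext
    rw [Units.val_one]
    refine (modularCyclotomicCharacter.unique (AlgebraicClosure K)
      (HasEnoughRootsOfUnity.natCard_rootsOfUnity (AlgebraicClosure K) p) _ fun t ht => ?_).symm
    rw [ZMod.val_one, pow_one]
    have ht' : ((t : (AlgebraicClosure K)ˣ) : AlgebraicClosure K) ^ p = 1 := by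
      rw [← Units.val_pow_eq_pow_val, (mem_rootsOfUnity p t).1 ht, Units.val_one]
    exact h _ ht'
  · intro h x hx
    rw [modPCyclotomicCharacterZMod_spec K p σ x hx, h, Units.val_one,
      ZMod.val_one'' (Fact.out : p.Prime).one_lt.ne', pow_one]

/-- **The mod-`p` cyclotomic character of `ℚ` is onto `(ℤ/p)ˣ`**: the `p`-adic character is onto
(`cyclotomicCharacter_surjective`, irreducibility of the cyclotomic polynomials over `ℚ`) and
`χ̄_p = χ_p mod p` (`toZMod_cyclotomicCharacter_apply`); the same statement is proved for
Serre 1972 §5.2 (iii) in the tree's elliptic-curve files. [cite: Serre1972, §5.2 (iii)] -/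
theorem modPCyclotomicCharacterZMod_rat_surjective' (p : ℕ) [Fact p.Prime] [NeZero (p : ℚ)] :
    Function.Surjective (modPCyclotomicCharacterZMod ℚ p) := by
  intro u
  obtain ⟨y, hy⟩ := ZMod.ringHom_surjective (PadicInt.toZMod (p := p)) (u : ZMod p)
  have hyu : IsUnit y := by
    by_contra h
    have hmem : y ∈ IsLocalRing.maximalIdeal ℤ_[p] := h
    rw [← PadicInt.ker_toZMod, RingHom.mem_ker, hy] at hmem
    exact u.ne_zero hmem
  obtain ⟨σ, hσ⟩ := GaloisRep.cyclotomicCharacter_surjective ℚ p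
    (fun n hn ↦ Polynomial.cyclotomic.irreducible_rat hn) hyu.unit
  refine ⟨σ, Units.ext ?_⟩
  rw [← toZMod_cyclotomicCharacter_apply ℚ p σ, hσ, IsUnit.unit_spec, hy]

/-- `2² = 4 ≠ 1` in `(ℤ/p)ˣ` for a prime `p ≥ 5`: the unit `2` has `χ`-value of order `> 2`.
[folklore] -/
theorem unitOfCoprime_two_sq_ne_one (p : ℕ) [Fact p.Prime] (hp5 : 5 ≤ p) (h2 : Nat.Coprime 2 p) :
    (ZMod.unitOfCoprime 2 h2) ^ 2 ≠ (1 : (ZMod p)ˣ) := by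
  intro h
  have h' := congrArg (fun u : (ZMod p)ˣ => (u : ZMod p)) h
  simp only [Units.val_pow_eq_pow_val, ZMod.coe_unitOfCoprime, Units.val_one, Nat.cast_ofNat] at h'
  have h3 : ((3 : ℕ) : ZMod p) = 0 := by push_cast; linear_combination h'
  rw [ZMod.natCast_eq_zero_iff] at h3
  have := Nat.le_of_dvd (by norm_num) h3
  omega

end Cyclotomic

/-! ### The stub -/

/-- **Stub `stub_bigImageScalar` (S3) of line `birth`: Dickson.**  For `p ≥ 11` and
`τ₀ : Γ_ℚ → GL₂(ℤ̄_p/𝔪)` with finite image, `ad⁰τ₀` absolutely irreducible on `Γ_{ℚ(ζ_p)}` and an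
element of projective order `> 5`: (i) the projective image of `τ₀|_{Γ_{ℚ(ζ_p)}}` is conjugate to a
group between `PSL₂(𝔽)` and `PGL₂(𝔽)` for a finite subfield `𝔽 ≤ ℤ̄_p/𝔪`
(`BigProjImageOnCyclotomic`); (ii) every twisted adjoint `τ = P (η̄ · Ad τ₀) P⁻¹` takes a scalar
value at some `σ ∉ Γ_{ℚ(ζ_p)}` (`ScalarOffCyclotomic`, through the glue `scalarOffCyclotomic_of_isTwistedAdZero`: `σ = σ₀² d⁻¹`
with `χ̄_p(σ₀) = 2`, `d ∈ [Γ_ℚ, Γ_ℚ]`, `τ₀ σ` scalar).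
[cite: ACCGHLNSTT2023, §7.1, proof of Lemma 7.1.5 and Lemma 7.1.6 (2)] -/
theorem stub_bigImageScalar :
    ∀ (p : ℕ) [Fact p.Prime], 11 ≤ p →
      ∀ τ₀ : absoluteGaloisGroup ℚ →* GL (Fin 2) (padicAlgClResidueField p),
        (Set.range τ₀).Finite →
        IsAbsIrreducible ((adZeroOf τ₀).comp (absGaloisGroupAdjoinRootsOfUnity ℚ p).subtype) →
        HasProjOrderGtFive τ₀ →
          BigProjImageOnCyclotomic p τ₀ ∧
            ∀ (τ : absoluteGaloisGroup ℚ →* GL (Fin 3) (padicAlgClResidueField p))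
              (ηb : absoluteGaloisGroup ℚ →* GL (Fin 1) (padicAlgClResidueField p)),
              IsTwistedAdZero τ τ₀ ηb → ScalarOffCyclotomic p τ := by
  intro p _ hp τ₀ hfin hirr hord
  classical
  have hpp : p.Prime := Fact.out
  haveI : CharP (padicAlgClResidueField p) p := charP_padicAlgClResidueField p
  haveI : IsAlgClosed (padicAlgClResidueField p) :=
    Literature.RingTheory.Valuation.isAlgClosed_residueField (padicAlgClIntegers p)
  haveI : NeZero p := ⟨hpp.ne_zero⟩
  set G' := absGaloisGroupAdjoinRootsOfUnity ℚ p with hG'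
  set χ := modPCyclotomicCharacterZMod ℚ p with hχ
  have hmem : ∀ σ, σ ∈ G' ↔ χ σ = 1 := fun σ => mem_absGaloisGroupAdjoinRootsOfUnity_iff_modP σ
  have hcomm : commutator (absoluteGaloisGroup ℚ) ≤ G' := fun σ hσ =>
    (hmem σ).2 (Abelianization.commutator_subset_ker χ hσ)
  -- irreducibility of `Ad ∘ τ₀` on `G'`
  have hirr' : (glRepresentation ((glAdZeroTwoFrame (padicAlgClResidueField p)).comp
      (τ₀.comp G'.subtype))).IsIrreducible := by
    have h1 := hirr (padicAlgClResidueField p) (RingHom.id _)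
    rwa [Matrix.GeneralLinearGroup.map_id, MonoidHom.id_comp] at h1
  have hord' : ∃ h ∈ projectiveImage τ₀, 5 < orderOf h := by
    obtain ⟨g, hg⟩ := hord
    exact ⟨_, mk_apply_mem_projectiveImage τ₀ g, hg⟩
  obtain ⟨F, t, hF, h1, h2, hsq⟩ := pslTwo_le_conj_projectiveImage_comp_subtype (p := p)
    (by omega) τ₀ hfin G' hcomm
    (fun x => exists_mem_projectiveImage_smul_ne (τ₀.comp G'.subtype) hirr' x)
    (fun x y hxy => exists_mem_projectiveImage_not_smul_pair (τ₀.comp G'.subtype) hirr' x y hxy)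
    hord'
  refine ⟨⟨F, t, hF, h1, le_trans (Subgroup.pointwise_smul_le_pointwise_smul_iff.mpr
    (projectiveImage_comp_subtype_le τ₀ G')) h2⟩, ?_⟩
  -- the scalar element: `σ = σ₀² d⁻¹` with `χ̄_p(σ₀) = 2`, `d ∈ [Γ_ℚ, Γ_ℚ]`, `proj τ₀ σ = 1`
  intro τ ηb hτ
  refine scalarOffCyclotomic_of_isTwistedAdZero hτ ?_
  have h2p : Nat.Coprime 2 p := (Nat.coprime_primes (by norm_num) hpp).mpr (by omega)
  obtain ⟨σ₀, hσ₀⟩ := modPCyclotomicCharacterZMod_rat_surjective' p (ZMod.unitOfCoprime 2 h2p)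
  obtain ⟨d, hd, hdeq⟩ := hsq σ₀
  have hπσ : Matrix.ProjGenLinGroup.mk (τ₀ (σ₀ ^ 2 * d⁻¹)) = 1 := by
    rw [map_mul, map_inv, map_pow, map_mul, map_inv, map_pow, hdeq, mul_inv_cancel]
  have hσG' : σ₀ ^ 2 * d⁻¹ ∉ G' := by
    rw [hmem, map_mul, map_inv, map_pow, (hmem d).1 (hcomm hd), inv_one, mul_one,
      show χ σ₀ = ZMod.unitOfCoprime 2 h2p from hσ₀]
    exact unitOfCoprime_two_sq_ne_one p (by omega) h2p
  obtain ⟨u, hu⟩ : ∃ u, Matrix.GeneralLinearGroup.scalar (Fin 2) u = τ₀ (σ₀ ^ 2 * d⁻¹) := by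
    have hc := Matrix.ProjGenLinGroup.mk_eq_one.mp hπσ
    rwa [Matrix.GeneralLinearGroup.center_eq_range_scalar] at hc
  refine ⟨σ₀ ^ 2 * d⁻¹, hσG', (u : padicAlgClResidueField p), ?_⟩
  rw [← hu, Matrix.GeneralLinearGroup.coe_scalar, Matrix.scalar_apply, Matrix.smul_one_eq_diagonal]

end Summit.Langlands.Langlands.Cruxes.AdjointLiftingGL3.Birth

end
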